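import Summits.ValiantsHypothesis.ValiantsHypothesis.Theorems.LacunarySymmetroidMatrixDescartesCensusRootSideM4
import Summits.ValiantsHypothesis.ValiantsHypothesis.Theorems.LacunarySymmetroidMatrixDescartesCensusRootSideDefs
import Summits.ValiantsHypothesis.ValiantsHypothesis.Theorems.LacunarySymmetroidMatrixDescartesCensusMirror

/-!
# `MatrixDescartes` census — link: «M4-POS(0,2,3,7,15,26) ⇒ no twenty on (0,2,3,7,15,26) and on its mirror» (kernel)

HONEST FRAMING.  Object-search cell `pub-symmetroid`, route crux `Theses.LacunarySymmetroid.MatrixDescartes`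
(stmt-ValiantsHypothesis-18050).  The never-asserted candidate statement `M4Pos_0_2_3_7_15_26`
(`…CensusRootSideDefs.lean`; engine-5 g14 E5G14-RANK3 §4b, lead R1131 — OPEN, located) IMPLIES the V = 20 row of
`DoorA26` on the single support `(0,2,3,7,15,26)`, BOTH orientations (the minor is homogeneous of even degree), and —
by the mirror invariance of table rows (`Census.posRootLawOn_two_six_mirror`, `x ↦ 1/x`) — on the mirror support
`(0,11,19,23,24,26)`: every real symmetric `2 × 2` six-term pencil on these exponents has at most `19` distinct positive
determinant roots.  Proof = the root-side schema `Census.card_posRoots_le_19_of_minor_four_ne_zero`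
(`…CensusRootSideM4.lean` over `…CensusRootSide.lean`: a twenty's coefficients are `t · c(ρ)`, `t ≠ 0`, by
`Literature.Analysis.TotalPositivity.exists_roots_coeff_eq_mul_signedMinor`; the `4 × 4` minor of `Ĝ(coefficients)`
vanishes by `gram_det_cross_four_eq_zero`; it scales by `t⁴`), with the 2-Sidon property of `(0,2,3,7,15,26)`, the
index table `m4posU` and the sortedness of `m4posE` discharged by `decide`.  The «rank-20 / total-positivity fact»
(R1131) is NOT a hypothesis: it is the Literature theorem `det_pow_strictMono_pos` (Gantmacher Vol. 2 XIII §8 Ex. 1).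
Nothing here asserts `M4-POS`, bears on `DoorA26` (OPEN) as a format-level statement, on `MatrixDescartes`, or on
`VP ≠ VNP`. [folklore]
-/

-- `Summit.ValiantsHypothesis.ValiantsHypothesis.…` repeats a component by the D-0017 layout
-- (single-conjunct summit), which the `dupNamespace` linter flags; the name is mandated.
set_option linter.dupNamespace false

namespace Summit.ValiantsHypothesis.ValiantsHypothesis.Theorems.LacunarySymmetroidMatrixDescartes.Census

open Polynomial Finset
open scoped BigOperators Polynomial Matrix

/-- **M4-POS ⇒ no twenty on `(0,2,3,7,15,26)`** (unfolded row).  If engine-5's candidate statement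
`M4Pos_0_2_3_7_15_26` holds (the root-side minor `m4posMinor ρ` is positive for every sorted positive `ρ : Fin 20 → ℝ`),
then every real symmetric `2 × 2` six-term pencil on the exponents `(0,2,3,7,15,26)` has at most `19` distinct positive
determinant roots. [folklore] -/
theorem posRoots_le_19_on_2_6_0_2_3_7_15_26_of_m4Pos (h : M4Pos_0_2_3_7_15_26)
    (S : Fin 6 → Matrix (Fin 2) (Fin 2) ℝ) (hS : ∀ l, (S l).IsSymm) :
    ((∑ l, ((X : ℝ[X]) ^ (![0, 2, 3, 7, 15, 26] : Fin 6 → ℕ) l) • (S l).map C).det.roots.toFinset.filter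
      (fun t => 0 < t)).card ≤ 19 := by
  refine card_posRoots_le_19_of_minor_four_ne_zero (![0, 2, 3, 7, 15, 26] : Fin 6 → ℕ) (by decide)
    m4posE (Fin.strictMono_iff_lt_succ.mpr (by decide)) m4posU (by decide)
    (![0, 1, 2, 4] : Fin 4 → Fin 6) (![0, 2, 3, 4] : Fin 4 → Fin 6) (fun ρ hρ0 hρ => ?_) S hS
  exact (h ρ hρ0 hρ).ne'

/-- **M4-POS ⇒ the table row `ζ(2,6; (0,2,3,7,15,26)) ≤ 19`** in the cell's row currency `PosRootLawOn`
(`…CensusDefs.lean`). [folklore] -/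
theorem posRootLawOn_0_2_3_7_15_26_of_m4Pos (h : M4Pos_0_2_3_7_15_26) :
    PosRootLawOn 2 6 19 ![0, 2, 3, 7, 15, 26] :=
  fun S hS => posRoots_le_19_on_2_6_0_2_3_7_15_26_of_m4Pos h S hS

/-- **M4-POS ⇒ the MIRROR row `ζ(2,6; (0,11,19,23,24,26)) ≤ 19`** (`x ↦ 1/x`, `Census.posRootLawOn_two_six_mirror`):
the candidate statement on `(0,2,3,7,15,26)` also excludes a twenty on the mirror support — the desk's «say which» of
R1166 (1): by the mirror LEMMA, no second minor needed. [folklore] -/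
theorem posRootLawOn_0_11_19_23_24_26_of_m4Pos (h : M4Pos_0_2_3_7_15_26) :
    PosRootLawOn 2 6 19 ![0, 11, 19, 23, 24, 26] := by
  have hm := posRootLawOn_two_six_mirror (B := 19) (![0, 2, 3, 7, 15, 26] : Fin 6 → ℕ) (by decide)
    (posRootLawOn_0_2_3_7_15_26_of_m4Pos h)
  have e : (fun l : Fin 6 => (![0, 2, 3, 7, 15, 26] : Fin 6 → ℕ) 5 - (![0, 2, 3, 7, 15, 26] : Fin 6 → ℕ) (Fin.rev l))
      = (![0, 11, 19, 23, 24, 26] : Fin 6 → ℕ) := by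
    funext l; fin_cases l <;> rfl
  rw [e] at hm
  exact hm

end Summit.ValiantsHypothesis.ValiantsHypothesis.Theorems.LacunarySymmetroidMatrixDescartes.Census
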